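import Summits.HodgeConjecture.HodgeConjecture.Theorems.F0P3CotangentFormValueMapAntihol
import Summits.HodgeConjecture.HodgeConjecture.Theorems.F0P3HolProjectionReduction
import HarnessLib

/-!
# FLOOR-0 P3 — the ∀-CLOSED VALUE-MAP HEADS consumed by the rung-1 folds (ONE shared adapter over brief B1′)

Cell hodgecm-mathlib, FLOOR 0, crux item H413 = stmt-HodgeConjecture-24833; rung-1 line `Cruxes/H413/Lines/F0_U3LettersRung1.lean`
(contract v3).  PROOF lane (no `def`); author F0P3-p03 (g3).

The three consumers of brief B1′ (★ `F0P3CotangentFormValueMap`, F0P3-p01 (g3)) — F0P3-p04 (g3)'s E1′h head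
★ `F0P3CohFinComponentUniqueOfE1.cohFinComponentUnique_hol_of_valueMaps(_of_holType)` (`hVal`), F0P3-p03 (g3)'s E2′₀ fold
★ `F0P3HodgeTypeRigidDiag.not_isHol_isAntihol_of_valueMaps` (`hvh`) and the β-closer ★
`F0P3HodgeTypeRigidOfArchRigid.hodgeTypeRigid_of_cohArchComponentRigid` (`hVal`) — all take the SAME ∀-closed hypothesis
«for every CM frame (`hdef`, `h2`), every automorphic `μ`, every discrete `P` and every non-zero holomorphic cotangent form `Φ`
with `P.ContainsForm Φ` there is a NON-ZERO typed-`+I` null value map `φ : 𝔲(2,1) →ₗ[ℝ] P.archModuleCM ι T hT`» (five conjuncts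
= the `φp` binders of ★ S2 `F0P3ValueMapTransport.not_both_types_of_detected`).  `hVal_hol` IS that statement, proved ONCE from
p01's pointwise head `F0P3CotangentFormValueMap.valueMap_hol` (classes `exists_vectors`, value map ★
`F0P3ValueMapOfFrameVectors.exists_valueMap` at `χ = id`; the quotient is compact by ★
`F0P3HolProjectionReduction.compactSpace_automorphicQuotient_cm`; `P.ContainsForm Φ` supplies the membership of the classes, the
`MemLp` witness being proof-irrelevant).  EDITION 2: the antiholomorphic twin `hVal_antihol` (types `−I`, forms `Ψ ∈ (holCotForms …).map conjFun`) over p01's sequel ★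
`F0P3CotangentFormValueMapAntihol` (`exists_vectors_antihol`, `valueMap_antihol`, value map ★ `exists_valueMap` at `χ = conj`).
References: [BorelWallach2000] II §4.1–4.2, VI 4.8; [Rogawski1990] Prop. 15.2.1 (b); [BorelJacquetCorvallis1979] §4.6.
HONEST LABEL: HC_CM is proved only modulo the printed citations until rung 0 closes; this file discharges none of them.
-/

-- Mathlib idiom (as in `GKModules`, ★ S0∕S2∕S3, ★ B1′): commutator bracket on `Module.End`
attribute [local instance 100] LieRing.ofAssociativeRing

set_option autoImplicit false
set_option linter.dupNamespace false

noncomputable section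

namespace Summit.HodgeConjecture.HodgeConjecture.Cruxes.H413.F0P3ValueMapHeads

open NumberField NumberField.InfinitePlace MeasureTheory
open scoped Matrix MatrixGroups ComplexOrder
open Literature.RepresentationTheory.BorelWallach2000
open Literature.NumberTheory.Automorphic Literature.NumberTheory.Automorphic.UnitaryGroup
open Literature.NumberTheory.Automorphic.UnitaryGroup.CotangentForms
open Literature.RepresentationTheory.KonnoKonno2007 Literature.RepresentationTheory.KonnoKonno2007.RealDualPair
open Literature.RepresentationTheory.KonnoKonno2007.RealDualPair.UForm
open Summit.HodgeConjecture.HodgeConjecture.Cruxes.H413.F0P3CotangentFormValueMap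
open Summit.HodgeConjecture.HodgeConjecture.Cruxes.H413.F0P3CotangentFormL2Span (memLp_toQuotFun_apply)
open Summit.HodgeConjecture.HodgeConjecture.Cruxes.H413.F0P3CotangentFormValueMapAntihol
open Summit.HodgeConjecture.HodgeConjecture.Cruxes.H413.F0P3HolProjectionReduction (compactSpace_automorphicQuotient_cm)

/-- **The ∀-closed holomorphic value-map head** (the `hVal` ∕ `hvh` hypothesis of the rung-1 folds, token for token): for every
CM frame `(L, ι, H, T, hT)` with `H` definite away from `ι` and `[L⁺:ℚ] ≥ 2`, every automorphic `μ`, every discrete `P` and every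
`Φ ∈ holCotForms` with `Φ ≠ 0` and `P.ContainsForm Φ`, there is a NON-ZERO real-linear `φ : 𝔲(2,1)_{Fin 2 ⊕ Fin 1} → P.archModuleCM ι T hT`
satisfying the five typed-`+I` null value-map conditions h0 ∕ hK ∕ h𝔨 ∕ hwt ∕ hN for `(P.archRepKCM ι T hT, P.archRepLieCM ι T hT)` —
★ `F0P3CotangentFormValueMap.valueMap_hol` on the coordinate classes of `Φ` and the value map `φ(Y) = Σⱼ Y_{(inl j)(inr 0)} • [Φⱼ]`.
[cite: BorelWallach2000, II §4.1–4.2; VI 4.8] [cite: Rogawski1990, Prop. 15.2.1 (b)] [cite: BorelJacquetCorvallis1979, §4.6] -/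
theorem hVal_hol : ∀ (L : Type) [Field L] [NumberField L] [IsCMField L] (ι : L →+* ℂ) (H : Matrix (Fin 3) (Fin 3) L) (T : GL (Fin 3) ℂ)
    (hT : (T : Matrix (Fin 3) (Fin 3) ℂ)ᴴ * H.map ι * (T : Matrix (Fin 3) (Fin 3) ℂ) = Literature.Geometry.ComplexHyperbolic.BallModel.J),
    (∀ τ' : L →+* ℂ, InfinitePlace.mk τ' ≠ InfinitePlace.mk ι → (H.map τ').PosDef) →
    2 ≤ Module.finrank ℚ ↥(maximalRealSubfield L) →
    ∀ (μ : Measure (adelicGroupData (↥(maximalRealSubfield L)) L (IsCMField.complexConj L) 3 H).automorphicQuotient)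
    [(adelicGroupData (↥(maximalRealSubfield L)) L (IsCMField.complexConj L) 3 H).IsAutomorphicMeasure μ]
    (P : DiscreteAutomorphicRep (adelicGroupData (↥(maximalRealSubfield L)) L (IsCMField.complexConj L) 3 H) μ)
    (Φ : (adelicGroupData (↥(maximalRealSubfield L)) L (IsCMField.complexConj L) 3 H).Adelic → (Fin 2 → ℂ)),
    Φ ∈ CotangentForms.holCotForms (↥(maximalRealSubfield L)) L (IsCMField.complexConj L) 3 H (cmArchSection L ι H T hT)
      (cmCompactFactor L ι H T hT) → Φ ≠ 0 → P.ContainsForm Φ →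
    ∃ φ : (uFormGroup (Fin 2) (Fin 1)).lie →ₗ[ℝ] P.archModuleCM ι T hT, φ ≠ 0 ∧
      (∀ W ∈ (uFormGroup (Fin 2) (Fin 1)).kInLie, φ W = 0) ∧
      (∀ (k : (uFormGroup (Fin 2) (Fin 1)).maximalCompact) (X : (uFormGroup (Fin 2) (Fin 1)).lie),
        P.archRepKCM ι T hT k (φ X) =
          φ ((uFormGroup (Fin 2) (Fin 1)).Ad (Subgroup.inclusion (uFormGroup (Fin 2) (Fin 1)).maximalCompact_le_carrier k) X)) ∧
      (∀ W ∈ (uFormGroup (Fin 2) (Fin 1)).kInLie, ∀ X : (uFormGroup (Fin 2) (Fin 1)).lie,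
        φ ⁅W, X⁆ = P.archRepLieCM ι T hT W (φ X)) ∧
      (∀ X : (uFormGroup (Fin 2) (Fin 1)).lie, P.archRepLieCM ι T hT (upqZ0 (Fin 2) (Fin 1)) (φ X) = Complex.I • φ X) ∧
      (∀ (X : (uFormGroup (Fin 2) (Fin 1)).lie) (s : (Fin 2 × Fin 1) × Fin 2),
        P.archRepLieCM ι T hT (upqPBasis s) (φ X) +
          Complex.I • P.archRepLieCM ι T hT ⁅upqZ0 (Fin 2) (Fin 1), upqPBasis s⁆ (φ X) = 0) := by
  intro L _ _ _ ι H T hT hdef h2 μ _ P Φ hΦ hΦ0 hcont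
  haveI := compactSpace_automorphicQuotient_cm (H := H) hdef h2
  -- the coordinate classes lie in `P` (`ContainsForm`; the `MemLp` witness is irrelevant)
  have hP : ∀ j : Fin 2, (memLp_toQuotFun_apply ι T hT (μ := μ) hΦ j).toLp _ ∈ P.space.toSubmodule :=
    fun j => (hcont j).elim fun _ hh => hh
  -- term mode on purpose: `obtain` on these existentials runs `whnf` past the default heartbeats
  exact (exists_vectors ι T hT P hΦ hP).elim fun v hv =>
    (F0P3ValueMapOfFrameVectors.exists_valueMap (V := ↥(P.archModuleCM ι T hT)) LinearMap.id v).elim fun φ hφ =>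
      have h := valueMap_hol ι T hT P hΦ v hv φ hφ
      ⟨φ, h.2.2.2.2.2 hΦ0, h.1, h.2.1, h.2.2.1, h.2.2.2.1, h.2.2.2.2.1⟩


/-- **The ∀-closed antiholomorphic value-map head** (the `hVal'` ∕ `hva` hypothesis of the rung-1 folds, token for token): for every
CM frame, automorphic `μ`, discrete `P` and every `Ψ ∈ (holCotForms …).map conjFun` (a complex conjugate `Φ̄` of a holomorphic cotangent
form) with `Ψ ≠ 0` and `P.ContainsForm Ψ`, there is a NON-ZERO real-linear `φ : 𝔲(2,1)_{Fin 2 ⊕ Fin 1} → P.archModuleCM ι T hT` satisfying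
the five typed-`−I` null value-map conditions (the `φm` binders of ★ S2) — ★ `F0P3CotangentFormValueMapAntihol.valueMap_antihol` on the
coordinate classes of `Φ̄` and the conjugate-linear value map `φ(Y) = Σⱼ conj(Y_{(inl j)(inr 0)}) • [Φ̄ⱼ]`.
[cite: BorelWallach2000, II §4.1–4.2; VI 4.8] [cite: Rogawski1990, Prop. 15.2.1 (b)] [cite: BorelJacquetCorvallis1979, §4.6] -/
theorem hVal_antihol : ∀ (L : Type) [Field L] [NumberField L] [IsCMField L] (ι : L →+* ℂ) (H : Matrix (Fin 3) (Fin 3) L) (T : GL (Fin 3) ℂ)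
    (hT : (T : Matrix (Fin 3) (Fin 3) ℂ)ᴴ * H.map ι * (T : Matrix (Fin 3) (Fin 3) ℂ) = Literature.Geometry.ComplexHyperbolic.BallModel.J),
    (∀ τ' : L →+* ℂ, InfinitePlace.mk τ' ≠ InfinitePlace.mk ι → (H.map τ').PosDef) →
    2 ≤ Module.finrank ℚ ↥(maximalRealSubfield L) →
    ∀ (μ : Measure (adelicGroupData (↥(maximalRealSubfield L)) L (IsCMField.complexConj L) 3 H).automorphicQuotient)
    [(adelicGroupData (↥(maximalRealSubfield L)) L (IsCMField.complexConj L) 3 H).IsAutomorphicMeasure μ]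
    (P : DiscreteAutomorphicRep (adelicGroupData (↥(maximalRealSubfield L)) L (IsCMField.complexConj L) 3 H) μ)
    (Ψ : (adelicGroupData (↥(maximalRealSubfield L)) L (IsCMField.complexConj L) 3 H).Adelic → (Fin 2 → ℂ)),
    Ψ ∈ (CotangentForms.holCotForms (↥(maximalRealSubfield L)) L (IsCMField.complexConj L) 3 H (cmArchSection L ι H T hT)
      (cmCompactFactor L ι H T hT)).map (CotangentForms.conjFun (↥(maximalRealSubfield L)) L (IsCMField.complexConj L) 3 H) →
      Ψ ≠ 0 → P.ContainsForm Ψ →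
    ∃ φ : (uFormGroup (Fin 2) (Fin 1)).lie →ₗ[ℝ] P.archModuleCM ι T hT, φ ≠ 0 ∧
      (∀ W ∈ (uFormGroup (Fin 2) (Fin 1)).kInLie, φ W = 0) ∧
      (∀ (k : (uFormGroup (Fin 2) (Fin 1)).maximalCompact) (X : (uFormGroup (Fin 2) (Fin 1)).lie),
        P.archRepKCM ι T hT k (φ X) =
          φ ((uFormGroup (Fin 2) (Fin 1)).Ad (Subgroup.inclusion (uFormGroup (Fin 2) (Fin 1)).maximalCompact_le_carrier k) X)) ∧
      (∀ W ∈ (uFormGroup (Fin 2) (Fin 1)).kInLie, ∀ X : (uFormGroup (Fin 2) (Fin 1)).lie,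
        φ ⁅W, X⁆ = P.archRepLieCM ι T hT W (φ X)) ∧
      (∀ X : (uFormGroup (Fin 2) (Fin 1)).lie, P.archRepLieCM ι T hT (upqZ0 (Fin 2) (Fin 1)) (φ X) = (-Complex.I) • φ X) ∧
      (∀ (X : (uFormGroup (Fin 2) (Fin 1)).lie) (s : (Fin 2 × Fin 1) × Fin 2),
        P.archRepLieCM ι T hT (upqPBasis s) (φ X) +
          (-Complex.I) • P.archRepLieCM ι T hT ⁅upqZ0 (Fin 2) (Fin 1), upqPBasis s⁆ (φ X) = 0) := by
  intro L _ _ _ ι H T hT hdef h2 μ _ P Ψ hΨ hΨ0 hcont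
  haveI := compactSpace_automorphicQuotient_cm (H := H) hdef h2
  -- `Ψ = Φ̄` for a holomorphic cotangent form `Φ` (term-mode elimination: `obtain … rfl` on `Submodule.mem_map` trips `whnf`)
  exact (Submodule.mem_map.1 hΨ).elim fun Φ hΦ2 => hΦ2.elim fun hΦ hΦΨ => by
    subst hΦΨ
    have hP : ∀ j : Fin 2, (memLp_toQuotFun_conjFun_apply ι T hT (μ := μ) hΦ j).toLp _ ∈ P.space.toSubmodule :=
      fun j => (hcont j).elim fun _ hh => hh
    -- the conjugation as a REAL-linear map whose application is `starRingEnd ℂ` definitionally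
    let χ : ℂ →ₗ[ℝ] ℂ :=
      { toFun := fun z => (starRingEnd ℂ) z
        map_add' := fun z z' => map_add (starRingEnd ℂ) z z'
        map_smul' := fun r z => by
          rw [RingHom.id_apply, Complex.real_smul, Complex.real_smul, map_mul, Complex.conj_ofReal] }
    exact (exists_vectors_antihol ι T hT P hΦ hP).elim fun w hw =>
      (F0P3ValueMapOfFrameVectors.exists_valueMap (V := ↥(P.archModuleCM ι T hT)) χ w).elim fun φ hφ =>
        have h := valueMap_antihol ι T hT P hΦ w hw φ hφ
        ⟨φ, h.2.2.2.2.2 hΨ0, h.1, h.2.1, h.2.2.1, h.2.2.2.1, h.2.2.2.2.1⟩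

end Summit.HodgeConjecture.HodgeConjecture.Cruxes.H413.F0P3ValueMapHeads

end
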